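/-
HONEST FRAMING: certified error envelopes and provably optimal rounding/accumulation schemes for
low-precision formats under stated cost models; every table by two implementations; no hardware or
vendor claims.
-/
import Summits.Ventures.CertifiedArithmetic.LowPrec.OptChainLabelsEffWitness

/-!
# The labelled chain law under ROUND-TO-NEAREST-EVEN (OPTIMA.md §B, Theorem T9(f)(ii)):
# the certified RNE attainment criterion is SUFFICIENT, for every pattern

Certificate C21 established (3451/3451 rows: precisions `≤ 5`, `≤ 3` steps, exact either way) that
under round-to-nearest-EVEN the constant `1 + U` of T9(a) is attained EXACTLY WHEN (`rne_rule`)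
every conversion of the chain is lossy and is fed by a format at least TWO bits wider than its
target — mere lossiness (one bit) suffices for a first-step conversion, fed by the free start value.
This file proves the "if" half for EVERY start precision `e₀ ≥ 2` and EVERY add/convert pattern
with precisions `≥ 2` (`RNEGap`): for ANY family of nearest roundings that resolves ties to EVEN
(`TiesToEven`; IEEE-754 roundTiesToEven is one, and such maps exist for every format with `p ≥ 2`,
`exists_roundNearest_tiesToEven`) the back-built witness of part 2 (`witSteps`) realises the
pattern with `S_n = 2^E` and `acc + Σ x_i = (1 + U) · S_n` (`lchain_rne_attained`,
`R4_LabelledChainLawRNE_holds`).  WHY TWO BITS: a charged step at precision `π` has to turn the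
midpoint `v + u_π 2^E` into `v`, which under ties-to-even needs `v` EVEN in `F(π)`
(`fl_midpoint_even`); `v = 2^E (1 + R)`, `R` the run sum of the lossy conversions that follow, with
leading term `u_{π'}`, `π'` the next conversion's precision — so `v` is even iff `π' ≤ π - 2`.
The "only if" half (strictness whenever the criterion fails) is `lchain_rne_strict` in
`OptChainLabelsRNEConverse.lean` (`rne_criterion_iff` there packages both directions).
-/

namespace Summit.Ventures.CertifiedArithmetic.LowPrec.Opt

open Literature.ComputerArithmetic.JeannerodRump2018

/-! ## Even floats and ties-to-even -/

/-- `v` is an EVEN float of `F(p, emin)`: `v = M · 2^e` with `|M| < 2^(p-1)` and `e ≥ emin + 1`,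
i.e. `v = (2M) · 2^(e-1)` — an even `p`-digit significand with exponent `≥ emin`.  For `p ≥ 2`
these are exactly the members of `F(p, emin)` whose normalised (or subnormal) significand is even:
the candidates IEEE-754 roundTiesToEven prefers at a tie. -/
def IsEvenFloat (p : ℕ) (emin : ℤ) (v : ℚ) : Prop := IsFloat (p - 1) (emin + 1) v

/-- Even floats are floats. -/
theorem IsEvenFloat.isFloat {p : ℕ} {emin : ℤ} {v : ℚ} (h : IsEvenFloat p emin v) :
    IsFloat p emin v := by
  obtain ⟨M, e, hM, he, rfl⟩ := h
  exact ⟨M, e, lt_of_lt_of_le hM (pow_le_pow_right₀ (by norm_num) (Nat.sub_le p 1)),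
    by omega, rfl⟩

/-- THE TIES-TO-EVEN RULE: `fl t` is even whenever some EVEN float other than `fl t` is (at least)
as near to `t` — among equally near candidates an even one is taken whenever there is one.
Round-to-nearest maps obeying IEEE-754 roundTiesToEven satisfy it by definition (there, of two
adjacent floats exactly one is even, `p ≥ 2`); such maps exist for every format
(`exists_roundNearest_tiesToEven`). -/
def TiesToEven (p : ℕ) (emin : ℤ) (fl : ℚ → ℚ) : Prop :=
  ∀ t f : ℚ, IsEvenFloat p emin f → f ≠ fl t → |t - f| ≤ |t - fl t| → IsEvenFloat p emin (fl t)

/-- A float `≥ 2^E` of `F(q)` is an integral multiple of `2^(E+1-q)`. -/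
theorem IsFloat.exists_int_mul_zpow {q : ℕ} {emin E : ℤ} {v : ℚ} (hv : IsFloat q emin v)
    (hEv : (2 : ℚ) ^ E ≤ v) : ∃ k : ℤ, v = (k : ℚ) * (2 : ℚ) ^ (E + 1 - q) := by
  obtain ⟨M, e, hM, -, rfl⟩ := hv
  have he := exp_ge_of_two_zpow_le hM hEv
  obtain ⟨a, ha⟩ := Int.eq_ofNat_of_zero_le (show 0 ≤ e - (E + 1 - q) by omega)
  refine ⟨M * 2 ^ a, ?_⟩
  push_cast
  rw [mul_assoc, ← zpow_natCast, ← zpow_add₀ (by norm_num : (2 : ℚ) ≠ 0)]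
  congr 2
  omega

/-- Two even floats `≥ 2^E` of `F(p)` never differ by `2 u_p 2^E = 2^(E+1-p)`: both are
multiples of `2^(E+2-p)`. -/
theorem IsEvenFloat.ne_add_two_ulp {p : ℕ} {emin E : ℤ} {v w : ℚ} (hp : 1 ≤ p)
    (hv : IsEvenFloat p emin v) (hw : IsEvenFloat p emin w)
    (hEv : (2 : ℚ) ^ E ≤ v) (hEw : (2 : ℚ) ^ E ≤ w) :
    w ≠ v + (2 : ℚ) ^ (E + 1 - p) := by
  obtain ⟨k, hk⟩ := IsFloat.exists_int_mul_zpow hv hEv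
  obtain ⟨k', hk'⟩ := IsFloat.exists_int_mul_zpow hw hEw
  have hs : E + 1 - ((p - 1 : ℕ) : ℤ) = (E + 1 - p) + 1 := by omega
  rw [hs, zpow_add_one₀ (by norm_num : (2 : ℚ) ≠ 0)] at hk hk'
  intro h
  have hpos : (0 : ℚ) < (2 : ℚ) ^ (E + 1 - (p : ℤ)) := zpow_pos (by norm_num) _
  have key : (((2 * (k' - k) - 1 : ℤ)) : ℚ) * (2 : ℚ) ^ (E + 1 - (p : ℤ)) = 0 := by
    push_cast
    calc (2 * ((k' : ℚ) - k) - 1) * (2 : ℚ) ^ (E + 1 - (p : ℤ))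
        = (k' : ℚ) * ((2 : ℚ) ^ (E + 1 - (p : ℤ)) * 2)
            - ((k : ℚ) * ((2 : ℚ) ^ (E + 1 - (p : ℤ)) * 2) + (2 : ℚ) ^ (E + 1 - (p : ℤ))) := by
          ring
      _ = 0 := by rw [← hk, ← hk', h]; ring
  have hz : ((2 * (k' - k) - 1 : ℤ) : ℚ) = 0 := (mul_eq_zero.mp key).resolve_right hpos.ne'
  have hz' : (2 * (k' - k) - 1 : ℤ) = 0 := by exact_mod_cast hz
  omega

/-- THE MIDPOINT GOES TO THE EVEN SIDE: a ties-to-even nearest map into `F(p)` sends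
`v + u_p 2^E`, `v ≥ 2^E` an EVEN float of `F(p)`, to `v` — the competitor `v + 2 u_p 2^E` is odd. -/
theorem fl_midpoint_even {p : ℕ} {emin E : ℤ} {fl : ℚ → ℚ} (hp : 1 ≤ p)
    (hfl : IsRoundNearest p emin fl) (hte : TiesToEven p emin fl) {v : ℚ}
    (hv : IsEvenFloat p emin v) (hEv : (2 : ℚ) ^ E ≤ v) :
    fl (v + (2 : ℚ) ^ E * unitRoundoff p) = v := by
  have hvF : IsFloat p emin v := hv.isFloat
  rw [two_zpow_mul_unitRoundoff]
  set t := v + (2 : ℚ) ^ (E - p) with ht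
  have hpos : (0 : ℚ) < (2 : ℚ) ^ (E - p) := zpow_pos (by norm_num) _
  have hδ : (2 : ℚ) ^ (E + 1 - p) = 2 * (2 : ℚ) ^ (E - p) := by
    rw [show E + 1 - (p : ℤ) = (E - p) + 1 by omega, zpow_add_one₀ (by norm_num : (2 : ℚ) ≠ 0)]
    ring
  obtain ⟨hF, hmin⟩ := hfl t
  have htv : |t - v| = (2 : ℚ) ^ (E - p) := by
    rw [show t - v = (2 : ℚ) ^ (E - p) by rw [ht]; ring]; exact abs_of_pos hpos
  have h1 : |t - fl t| ≤ (2 : ℚ) ^ (E - p) := htv ▸ hmin v hvF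
  obtain ⟨h1l, h1r⟩ := abs_le.mp h1
  have hlo : v ≤ fl t := by rw [ht] at h1r; linarith
  rcases eq_or_lt_of_le hlo with heq | hgt
  · exact heq.symm
  · exfalso
    have hge := float_succ_le hvF hEv hF hgt
    have hfe : fl t = v + (2 : ℚ) ^ (E + 1 - p) := by
      apply le_antisymm _ hge
      rw [hδ]; rw [ht] at h1l; linarith
    have htie : |t - v| ≤ |t - fl t| := by
      rw [htv, hfe, hδ, show t - (v + 2 * (2 : ℚ) ^ (E - ↑p)) = -((2 : ℚ) ^ (E - p)) by
        rw [ht]; ring, abs_neg, abs_of_pos hpos]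
    have heven := hte t v hv hgt.ne htie
    exact IsEvenFloat.ne_add_two_ulp hp hv heven hEv (hEv.trans hlo) hfe


/-- ROUND-TO-NEAREST, TIES-TO-EVEN MAPS EXIST for every format: take any nearest map and, whenever
some even float is as near, choose an even one. -/
theorem exists_roundNearest_tiesToEven (p : ℕ) (emin : ℤ) :
    ∃ fl : ℚ → ℚ, IsRoundNearest p emin fl ∧ TiesToEven p emin fl := by
  classical
  choose f hF hmin using exists_nearest p emin
  let Q : ℚ → Prop := fun t => ∃ g : ℚ, IsEvenFloat p emin g ∧ |t - g| ≤ |t - f t|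
  refine ⟨fun t => if h : Q t then Classical.choose h else f t, ?_, ?_⟩
  · intro t
    by_cases h : Q t
    · simp only [dif_pos h]
      obtain ⟨hg, hgt⟩ := Classical.choose_spec h
      exact ⟨hg.isFloat, fun g' hg' => hgt.trans (hmin t g' hg')⟩
    · simp only [dif_neg h]
      exact ⟨hF t, hmin t⟩
  · intro t g hg hne hle
    by_cases h : Q t
    · simp only [dif_pos h] at hne hle ⊢
      exact (Classical.choose_spec h).1
    · simp only [dif_neg h] at hne hle ⊢
      exact absurd ⟨g, hg, hle⟩ h

/-- A family of ties-to-even nearest maps, one per precision. -/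
theorem exists_tiesToEven_family (emin : ℤ) :
    ∃ fl : ℕ → ℚ → ℚ, ∀ π, IsRoundNearest π emin (fl π) ∧ TiesToEven π emin (fl π) := by
  choose fl h using fun π => exists_roundNearest_tiesToEven π emin
  exact ⟨fl, h⟩

/-! ## The certified criterion and the witness under ties-to-even -/

/-- THE RNE ATTAINMENT CRITERION of certificate C21 (`rne_rule`), for a pattern entered with
effective precision `e` (`first`: no rounding has happened yet): every conversion is LOSSY
(`π < e`) and, unless it is the first step, fed by a format at least two bits wider (`π + 2 ≤ e`);
after any step the effective precision is that step's precision. -/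
def RNEGap : ℕ → Bool → List (ℕ × Bool) → Prop
  | _, _, [] => True
  | e, first, (π, true) :: T => π < e ∧ (first = true ∨ π + 2 ≤ e) ∧ RNEGap π false T
  | _, _, (π, false) :: T => RNEGap π false T

/-- Under the criterion (non-first), entering one bit narrower changes no lossiness: the run sum
is the same. -/
theorem Rsum_eq_Rsum_pred {e : ℕ} : ∀ {T : List (ℕ × Bool)}, RNEGap e false T →
    Rsum e T = Rsum (e - 1) T
  | [], _ => by simp [Rsum]
  | (π, false) :: T, _ => by simp [Rsum]
  | (π, true) :: T, h => by
      obtain ⟨hlt, hgap, -⟩ := h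
      have h2 : π + 2 ≤ e := by simpa using hgap
      simp [Rsum, show ¬ (e ≤ π) by omega, show ¬ (e - 1 ≤ π) by omega]

/-- Under the criterion the witness value `2^E (1 + Rsum e T)` is an EVEN float of `F(e)`. -/
theorem isEvenFloat_witVal {emin E : ℤ} {e : ℕ} (he : 2 ≤ e) (heE : emin + e ≤ E + 1)
    {T : List (ℕ × Bool)} (hT : ∀ q ∈ T, 1 ≤ q.1) (hgap : RNEGap e false T) :
    IsEvenFloat e emin ((2 : ℚ) ^ E * (1 + Rsum e T)) := by
  rw [Rsum_eq_Rsum_pred hgap]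
  exact isFloat_witVal (by omega) (by omega) T hT

/-- THE WITNESS COMPUTATION ENDS AT `2^E` UNDER TIES-TO-EVEN, given the criterion. -/
theorem lchainEval_witSteps_even {emin E : ℤ} {fl : ℕ → ℚ → ℚ}
    (hfl : ∀ π, IsRoundNearest π emin (fl π) ∧ TiesToEven π emin (fl π)) :
    ∀ (P : List (ℕ × Bool)) (e : ℕ) (first : Bool), 1 ≤ e → emin + e ≤ E + 1 →
      (∀ q ∈ P, 2 ≤ q.1 ∧ emin + q.1 ≤ E + 1) → RNEGap e first P →
      lchainEval ((2 : ℚ) ^ E * (1 + Rsum e P)) (witSteps fl E P) = (2 : ℚ) ^ E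
  | [], e, _, _, _, _, _ => by simp [Rsum, witSteps]
  | (π, true) :: T, e, first, he, heE, hP, hgap => by
      obtain ⟨hπ, hπE⟩ := hP (π, true) (by simp)
      obtain ⟨hlt, -, hgapT⟩ := hgap
      have hT : ∀ q ∈ T, 2 ≤ q.1 ∧ emin + q.1 ≤ E + 1 := fun q hq => hP q (by simp [hq])
      have hT1 : ∀ q ∈ T, 1 ≤ q.1 := fun q hq => by have := (hT q hq).1; omega
      simp only [witSteps, lchainEval_cons, add_zero]
      rw [show Rsum e ((π, true) :: T) = unitRoundoff π + Rsum π T by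
            simp [Rsum, show ¬ (e ≤ π) by omega],
        show (2 : ℚ) ^ E * (1 + (unitRoundoff π + Rsum π T))
          = (2 : ℚ) ^ E * (1 + Rsum π T) + (2 : ℚ) ^ E * unitRoundoff π by ring,
        fl_midpoint_even (by omega) (hfl π).1 (hfl π).2 (isEvenFloat_witVal hπ hπE hT1 hgapT)
          (two_zpow_le_witVal E π T)]
      exact lchainEval_witSteps_even hfl T π false (by omega) hπE hT hgapT
  | (π, false) :: T, e, first, _, _, hP, hgap => by
      obtain ⟨hπ, hπE⟩ := hP (π, false) (by simp)
      have hgapT : RNEGap π false T := hgap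
      have hT : ∀ q ∈ T, 2 ≤ q.1 ∧ emin + q.1 ≤ E + 1 := fun q hq => hP q (by simp [hq])
      have hT1 : ∀ q ∈ T, 1 ≤ q.1 := fun q hq => by have := (hT q hq).1; omega
      simp only [witSteps, lchainEval_cons, Rsum]
      rw [show (2 : ℚ) ^ E * (1 + 0) + (2 : ℚ) ^ E * (unitRoundoff π + Rsum π T)
          = (2 : ℚ) ^ E * (1 + Rsum π T) + (2 : ℚ) ^ E * unitRoundoff π by ring,
        fl_midpoint_even (by omega) (hfl π).1 (hfl π).2 (isEvenFloat_witVal hπ hπE hT1 hgapT)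
          (two_zpow_le_witVal E π T)]
      exact lchainEval_witSteps_even hfl T π false (by omega) hπE hT hgapT

/-- Under the criterion every conversion is charged: the effective sum is the FULL sum `U`. -/
theorem ueff_witSteps_eq_usum (fl : ℕ → ℚ → ℚ) (E : ℤ) :
    ∀ (P : List (ℕ × Bool)) (e : ℕ) (first : Bool), RNEGap e first P →
      ueff e (witSteps fl E P) = usum (witSteps fl E P)
  | [], _, _, _ => by simp [witSteps]
  | (π, true) :: T, e, first, hgap => by
      obtain ⟨hlt, -, hgapT⟩ := hgap
      simp only [witSteps, ueff_cons, usum_cons, true_and, if_neg (show ¬ (e ≤ π) by omega)]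
      rw [ueff_witSteps_eq_usum fl E T π false hgapT]
  | (π, false) :: T, e, first, hgap => by
      have hgapT : RNEGap π false T := hgap
      have hx : ¬ ((2 : ℚ) ^ E * (unitRoundoff π + Rsum π T) = 0 ∧ e ≤ π) := by
        intro h
        have h0 : (0 : ℚ) < (2 : ℚ) ^ E := zpow_pos (by norm_num) _
        have hu : 0 < unitRoundoff π := by unfold unitRoundoff; positivity
        have := Rsum_nonneg π T
        nlinarith [h.1]
      simp only [witSteps, ueff_cons, usum_cons, if_neg hx]
      rw [ueff_witSteps_eq_usum fl E T π false hgapT]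

/-- T9(f)(ii), "if": UNDER ROUND-TO-NEAREST-EVEN THE FULL CONSTANT `1 + U` IS ATTAINED whenever
the criterion holds — for every start precision `e₀ ≥ 2`, every pattern with precisions `≥ 2`
satisfying `RNEGap e₀ true`, every scale `2^E` clear of underflow, and EVERY family of
ties-to-even nearest roundings: the witness gives `S_n = 2^E` and `acc + Σ x_i = (1 + U) · S_n`. -/
theorem lchain_rne_attained {emin E : ℤ} {fl : ℕ → ℚ → ℚ}
    (hfl : ∀ π, IsRoundNearest π emin (fl π) ∧ TiesToEven π emin (fl π))
    {e₀ : ℕ} (he₀ : 2 ≤ e₀) (he₀E : emin + e₀ ≤ E)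
    (P : List (ℕ × Bool)) (hP : ∀ q ∈ P, 2 ≤ q.1 ∧ emin + q.1 ≤ E) (hgap : RNEGap e₀ true P) :
    IsFloat e₀ emin ((2 : ℚ) ^ E * (1 + Rsum e₀ P)) ∧
    (∀ s ∈ witSteps fl E P, s.OK emin) ∧
    lchainEval ((2 : ℚ) ^ E * (1 + Rsum e₀ P)) (witSteps fl E P) = (2 : ℚ) ^ E ∧
    (2 : ℚ) ^ E * (1 + Rsum e₀ P) + xsum (witSteps fl E P)
      = (1 + usum (witSteps fl E P)) * lchainEval ((2 : ℚ) ^ E * (1 + Rsum e₀ P))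
          (witSteps fl E P) := by
  have hP1 : ∀ q ∈ P, 1 ≤ q.1 := fun q hq => by have := (hP q hq).1; omega
  have hP1' : ∀ q ∈ P, 1 ≤ q.1 ∧ emin + q.1 ≤ E :=
    fun q hq => ⟨hP1 q hq, (hP q hq).2⟩
  have hP' : ∀ q ∈ P, 2 ≤ q.1 ∧ emin + q.1 ≤ E + 1 :=
    fun q hq => ⟨(hP q hq).1, by linarith [(hP q hq).2]⟩
  have hev := lchainEval_witSteps_even hfl P e₀ true (by omega) (by omega) hP' hgap
  refine ⟨isFloat_witVal (by omega) (by omega) P hP1, witSteps_ok (fun π => (hfl π).1) P hP1',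
    hev, ?_⟩
  rw [hev, ← ueff_witSteps_eq_usum fl E P e₀ true hgap, ueff_witSteps, xsum_witSteps fl E P e₀]
  ring

/-- The witness steps round with the given maps. -/
theorem fl_witSteps (fl : ℕ → ℚ → ℚ) (E : ℤ) :
    ∀ (P : List (ℕ × Bool)), ∀ s ∈ witSteps fl E P, s.fl = fl s.prec
  | [], s, hs => by simp [witSteps] at hs
  | (π, true) :: T, s, hs => by
      simp only [witSteps, List.mem_cons] at hs
      rcases hs with rfl | hs
      · rfl
      · exact fl_witSteps fl E T s hs
  | (π, false) :: T, s, hs => by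
      simp only [witSteps, List.mem_cons] at hs
      rcases hs with rfl | hs
      · rfl
      · exact fl_witSteps fl E T s hs

/-! ## Statement-style packaging -/

/-- R4-style Prop (OPTIMA.md T9(f)(ii), the "if" half): UNDER ROUND-TO-NEAREST-EVEN the constant
`1 + U` of the labelled chain law is ATTAINED whenever the certified criterion `RNEGap` holds.
(1) For every `emin`, every scale `E`, every start precision `e₀ ≥ 2` with `emin + e₀ ≤ E`, every
add/convert pattern `P` (precisions `≥ 2`, `emin + π ≤ E`) with `RNEGap e₀ true P`, and EVERY
family `fl` of ties-to-even nearest roundings, some admissible chain realising `P` AND ROUNDING WITH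
THE GIVEN MAPS, from some `acc ∈ F(e₀)`, has `S_n = 2^E` and `acc + Σ x_i = (1 + U) · S_n`,
`U = Σ_i u_{π_i}`.  (2) Ties-to-even nearest families exist (the hypothesis of (1) is not void). -/
def R4_LabelledChainLawRNE : Prop :=
  (∀ (emin E : ℤ) (e₀ : ℕ), 2 ≤ e₀ → emin + e₀ ≤ E →
    ∀ P : List (ℕ × Bool), (∀ q ∈ P, 2 ≤ q.1 ∧ emin + q.1 ≤ E) → RNEGap e₀ true P →
    ∀ fl : ℕ → ℚ → ℚ, (∀ π, IsRoundNearest π emin (fl π) ∧ TiesToEven π emin (fl π)) →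
      ∃ (acc : ℚ) (ws : List LStep),
        ws.map (fun s => (s.prec, decide (s.x = 0))) = P ∧ (∀ s ∈ ws, s.fl = fl s.prec) ∧
        IsFloat e₀ emin acc ∧ (∀ s ∈ ws, s.OK emin) ∧ lchainEval acc ws = (2 : ℚ) ^ E ∧
        acc + xsum ws = (1 + usum ws) * lchainEval acc ws) ∧
  (∀ emin : ℤ, ∃ fl : ℕ → ℚ → ℚ, ∀ π, IsRoundNearest π emin (fl π) ∧ TiesToEven π emin (fl π))

/-- `R4_LabelledChainLawRNE` holds. -/
theorem R4_LabelledChainLawRNE_holds : R4_LabelledChainLawRNE := by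
  refine ⟨?_, exists_tiesToEven_family⟩
  intro emin E e₀ he₀ he₀E P hP hgap fl hfl
  obtain ⟨hacc, hok, hev, heq⟩ := lchain_rne_attained hfl he₀ he₀E P hP hgap
  exact ⟨_, witSteps fl E P, map_witSteps fl E P, fl_witSteps fl E P, hacc, hok, hev, heq⟩

/-! ## Sanity checks of the criterion against C21's `rne_rule` -/

/-- Start `F(5)`: conv3 (lossy, first step: one bit would do), add4, conv2 (`2 + 2 ≤ 4`). -/
example : RNEGap 5 true [(3, true), (4, false), (2, true)] := by simp [RNEGap]
/-- Start `F(4)`: add4 then conv3 — fed by a format only ONE bit wider: criterion fails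
(C21: `D_RNE < 1 + U` on such rows). -/
example : ¬ RNEGap 4 true [(4, false), (3, true)] := by simp [RNEGap]
/-- Start `F(3)`: conv3 is not lossy: criterion fails. -/
example : ¬ RNEGap 3 true [(3, true)] := by simp [RNEGap]
/-- Two consecutive lossy conversions need the two-bit gap between them: 5 → 3 → 2 fails at the
second, 5 → 4 → 2 holds. -/
example : ¬ RNEGap 5 true [(3, true), (2, true)] ∧ RNEGap 5 true [(4, true), (2, true)] := by
  simp [RNEGap]

end Summit.Ventures.CertifiedArithmetic.LowPrec.Opt
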